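import Mathlib
import Summits.KontsevichZagierPeriods.KontsevichZagierPeriods.Theorems.SoloInformedHesseTangential
import HarnessLib
import HarnessLib.Audit

/-!
# SoloInformed — Gauss triplication by the moves, II: the Lattès map `ρ_F` on the `x`-range of `C₀`

For `0 < F < 1/27` the Weyl chamber `C₀ = {0 < x < z < y}` of the oval `E_F(ℝ)⁰` of
`xyz = F, x+y+z = 1` projects onto the `x`-range
`S_F = {x | 0 < x < ⅓, x²(1−2x) < F, 4F < x(1−x)²}` (`= (x₋(F), p₁(F))`, cut out by `D_F(x) > 0`
and `q_F(x) > 0`). We prove, by Rolle and the intermediate value theorem only: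

* `soloInformed_rho_injOn` — `ρ_F = −q_F/D_F` is injective on `S_F` (Rolle + the key identity
  `ρ′²q = 4q∘ρ` of `SoloInformedHesseTangential`: `ρ′` never vanishes since `q_F > 0` on `(−∞,0)`);
* `soloInformed_rho_surj` — every `x′ < 0` is `ρ_F(x)` for some `x ∈ S_F` (three intermediate
  values: the endpoints `x₋`, `p₁` as roots of `x(1−x)² = 4F`, `x²(1−2x) = F` in `(0,⅓)`, then a root
  of the quartic `q_F + x′D_F` between them);
* `soloInformed_upperSheet` — over `x ∈ S_F` the point `(x, y₊)`, `y₊ = ((1−x) + √((1−x)² − 4F/x))/2`,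
  lies on `E_F` inside `C₀`; `soloInformed_negRoot_unique` — a point of the outer branch
  `B₃ = {x < 0, y < 0}` is determined by `x` and `F`.

Residency `solo-KontsevichZagierPeriods-informed` (s71); paper §7 (c6)(x).
References: Kontsevich–Zagier, *Periods* (2001), §1.2; Silverman, AEC III.2.
-/

noncomputable section

open Set
namespace Summit.KontsevichZagierPeriods.KontsevichZagierPeriods.Theorems

/-- The `x`-range of the chamber `C₀` at level `F`: `0 < x < ⅓`, `D_F(x) > 0`, `q_F(x) > 0`.
[this work] -/
def soloInformedRhoDom (F : ℝ) : Set ℝ :=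
  {x | 0 < x ∧ x < 1 / 3 ∧ x ^ 2 * (1 - 2 * x) < F ∧ 4 * F < x * (1 - x) ^ 2}

/-! ### Elementary inequalities -/

/-- `e(x) = x²(1−2x)` is monotone on `(-∞, ⅓]`. [folklore] -/
theorem soloInformed_e_mono {a b : ℝ} (ha : 0 ≤ a) (hab : a ≤ b) (hb : b ≤ 1 / 3) :
    a ^ 2 * (1 - 2 * a) ≤ b ^ 2 * (1 - 2 * b) := by
  have key : b ^ 2 * (1 - 2 * b) - a ^ 2 * (1 - 2 * a) =
      (b - a) * (a * (1 - 2 * a - b) + b * (1 - a - 2 * b)) := by ring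
  have h2 : 0 ≤ a * (1 - 2 * a - b) + b * (1 - a - 2 * b) := by
    nlinarith [mul_nonneg ha (by linarith : (0:ℝ) ≤ 1 - 2 * a - b),
      mul_nonneg (ha.trans hab) (by linarith : (0:ℝ) ≤ 1 - a - 2 * b)]
  nlinarith [mul_nonneg (sub_nonneg.2 hab) h2]

/-- `e` is strictly monotone on `(-∞, ⅓)`. [folklore] -/
theorem soloInformed_e_strictMono {a b : ℝ} (ha : 0 ≤ a) (hab : a < b) (hb : b < 1 / 3) :
    a ^ 2 * (1 - 2 * a) < b ^ 2 * (1 - 2 * b) := by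
  have key : b ^ 2 * (1 - 2 * b) - a ^ 2 * (1 - 2 * a) =
      (b - a) * (a * (1 - 2 * a - b) + b * (1 - a - 2 * b)) := by ring
  have h2 : 0 < a * (1 - 2 * a - b) + b * (1 - a - 2 * b) := by
    nlinarith [mul_nonneg ha (by linarith : (0:ℝ) ≤ 1 - 2 * a - b),
      mul_pos (ha.trans_lt hab) (by linarith : (0:ℝ) < 1 - a - 2 * b)]
  nlinarith [mul_pos (sub_pos.2 hab) h2]

/-- `E(x) = x(1−x)²` is monotone on `(-∞, ⅓]`. [folklore] -/
theorem soloInformed_E_mono {a b : ℝ} (hab : a ≤ b) (hb : b ≤ 1 / 3) :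
    a * (1 - a) ^ 2 ≤ b * (1 - b) ^ 2 := by
  have key : b * (1 - b) ^ 2 - a * (1 - a) ^ 2 =
      (b - a) * (1 - 2 * (a + b) + (a ^ 2 + a * b + b ^ 2)) := by ring
  have h2 : 0 ≤ 1 - 2 * (a + b) + (a ^ 2 + a * b + b ^ 2) := by
    nlinarith [mul_nonneg (sub_nonneg.2 hab) (sub_nonneg.2 hb), sq_nonneg (b - a), sq_nonneg (1 / 3 - b),
      sub_nonneg.2 hab, sub_nonneg.2 hb]
  nlinarith [mul_nonneg (sub_nonneg.2 hab) h2]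

/-- `E` is strictly monotone on `(-∞, ⅓)`. [folklore] -/
theorem soloInformed_E_strictMono {a b : ℝ} (hab : a < b) (hb : b < 1 / 3) :
    a * (1 - a) ^ 2 < b * (1 - b) ^ 2 := by
  have key : b * (1 - b) ^ 2 - a * (1 - a) ^ 2 =
      (b - a) * (1 - 2 * (a + b) + (a ^ 2 + a * b + b ^ 2)) := by ring
  have h2 : 0 < 1 - 2 * (a + b) + (a ^ 2 + a * b + b ^ 2) := by
    nlinarith [mul_nonneg (sub_pos.2 hab).le (sub_pos.2 hb).le, sq_nonneg (b - a), sq_nonneg (1 / 3 - b),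
      sub_pos.2 hab, sub_pos.2 hb]
  nlinarith [mul_pos (sub_pos.2 hab) h2]

/-- `e < E/4·4`: `x²(1−2x) < x(1−x)²/4` on `(0, ⅓)` (difference `x(3x−1)²/4`). [folklore] -/
theorem soloInformed_e_lt_E {x : ℝ} (h0 : 0 < x) (h : x < 1 / 3) :
    4 * (x ^ 2 * (1 - 2 * x)) < x * (1 - x) ^ 2 := by
  have : x * (1 - x) ^ 2 - 4 * (x ^ 2 * (1 - 2 * x)) = x * (3 * x - 1) ^ 2 := by ring
  have h1 : 0 < (3 * x - 1) ^ 2 := by nlinarith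
  nlinarith [mul_pos h0 h1]

/-! ### `D_F`, `q_F`, `ρ_F` on the range -/

/-- On `S_F`: `D_F(x) = F − x²(1−2x) > 0`. [this work] -/
theorem soloInformed_rhoD_pos {F x : ℝ} (hx : x ∈ soloInformedRhoDom F) : 0 < soloInformedRhoD F x := by
  obtain ⟨-, -, h3, -⟩ := hx
  unfold soloInformedRhoD; nlinarith

/-- On `S_F`: `q_F(x) = x(x(1−x)² − 4F) > 0`. [this work] -/
theorem soloInformed_rhoQ_pos {F x : ℝ} (hx : x ∈ soloInformedRhoDom F) : 0 < soloInformedRhoQ F x := by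
  obtain ⟨h1, -, -, h4⟩ := hx
  have : soloInformedRhoQ F x = x * (x * (1 - x) ^ 2 - 4 * F) := by unfold soloInformedRhoQ; ring
  rw [this]
  exact mul_pos h1 (by linarith)

/-- On `S_F`: `ρ_F(x) < 0`. [this work] -/
theorem soloInformed_rho_neg {F x : ℝ} (hx : x ∈ soloInformedRhoDom F) : soloInformedRho F x < 0 := by
  unfold soloInformedRho
  rw [neg_div]
  exact neg_neg_of_pos (div_pos (soloInformed_rhoQ_pos hx) (soloInformed_rhoD_pos hx))

/-- `S_F` is order-convex: with `a ≤ t ≤ b` and `a, b ∈ S_F`, also `t ∈ S_F`. [this work] -/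
theorem soloInformed_rhoDom_convex {F a b t : ℝ} (ha : a ∈ soloInformedRhoDom F)
    (hb : b ∈ soloInformedRhoDom F) (hat : a ≤ t) (htb : t ≤ b) : t ∈ soloInformedRhoDom F := by
  obtain ⟨ha0, ha3, hae, haE⟩ := ha
  obtain ⟨hb0, hb3, hbe, hbE⟩ := hb
  refine ⟨lt_of_lt_of_le ha0 hat, lt_of_le_of_lt htb hb3, ?_, ?_⟩
  · exact lt_of_le_of_lt (soloInformed_e_mono (ha0.le.trans hat) htb hb3.le) hbe
  · have := soloInformed_E_mono hat (htb.trans hb3.le)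
    linarith

/-- On `S_F`, `ρ_F′ ≠ 0` (key identity: `ρ′²·q = 4·q(ρ) > 0`). [this work] -/
theorem soloInformed_rho'_ne_zero {F x : ℝ} (hF : 0 < F) (hx : x ∈ soloInformedRhoDom F) :
    soloInformedRho' F x ≠ 0 := by
  intro h
  have key := soloInformed_rho_key (soloInformed_rhoD_pos hx).ne'
  rw [h] at key
  have hq : 0 < soloInformedRhoQ F (soloInformedRho F x) :=
    soloInformed_rhoQ_pos_of_neg hF (soloInformed_rho_neg hx)
  nlinarith

/-- **`ρ_F` is injective on `S_F`** (Rolle). [this work] -/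
theorem soloInformed_rho_injOn {F : ℝ} (hF : 0 < F) : InjOn (soloInformedRho F) (soloInformedRhoDom F) := by
  have main : ∀ a ∈ soloInformedRhoDom F, ∀ b ∈ soloInformedRhoDom F, a < b →
      soloInformedRho F a ≠ soloInformedRho F b := by
    intro a ha b hb hab heq
    have hmem : ∀ t ∈ Icc a b, t ∈ soloInformedRhoDom F := fun t ht =>
      soloInformed_rhoDom_convex ha hb ht.1 ht.2
    have hder : ∀ t ∈ Icc a b, HasDerivAt (soloInformedRho F) (soloInformedRho' F t) t := fun t ht =>
      soloInformed_hasDerivAt_rho (soloInformed_rhoD_pos (hmem t ht)).ne'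
    have hcont : ContinuousOn (soloInformedRho F) (Icc a b) := fun t ht =>
      (hder t ht).continuousAt.continuousWithinAt
    obtain ⟨c, hc, hc0⟩ := exists_hasDerivAt_eq_zero hab hcont heq
      (fun t ht => hder t (Ioo_subset_Icc_self ht))
    exact soloInformed_rho'_ne_zero hF (hmem c (Ioo_subset_Icc_self hc)) hc0
  intro a ha b hb h
  rcases lt_trichotomy a b with hab | hab | hab
  · exact absurd h (main a ha b hb hab)
  · exact hab
  · exact absurd h.symm (main b hb a ha hab)

/-- **`ρ_F` maps `S_F` onto `(−∞, 0)`** (`0 < F < 1/27`). [this work] -/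
theorem soloInformed_rho_surj {F : ℝ} (hF : 0 < F) (hF' : F < 1 / 27) {x' : ℝ} (hx' : x' < 0) :
    ∃ x ∈ soloInformedRhoDom F, soloInformedRho F x = x' := by
  -- the left endpoint x₋ : x(1-x)² = 4F
  have hE : ContinuousOn (fun t : ℝ => t * (1 - t) ^ 2) (Icc 0 (1 / 3)) := by fun_prop
  obtain ⟨xm, ⟨hxm0, hxm3⟩, hxmE⟩ : ∃ xm ∈ Ioo (0:ℝ) (1 / 3), xm * (1 - xm) ^ 2 = 4 * F := by
    have h := intermediate_value_Ioo (by norm_num : (0:ℝ) ≤ 1 / 3) hE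
    have h4 : 4 * F ∈ Ioo ((0:ℝ) * (1 - 0) ^ 2) (1 / 3 * (1 - 1 / 3) ^ 2) := by
      constructor <;> nlinarith
    exact h h4
  -- the right endpoint p₁ : x²(1-2x) = F
  have he : ContinuousOn (fun t : ℝ => t ^ 2 * (1 - 2 * t)) (Icc 0 (1 / 3)) := by fun_prop
  obtain ⟨p, ⟨hp0, hp3⟩, hpe⟩ : ∃ p ∈ Ioo (0:ℝ) (1 / 3), p ^ 2 * (1 - 2 * p) = F := by
    have h := intermediate_value_Ioo (by norm_num : (0:ℝ) ≤ 1 / 3) he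
    have h4 : F ∈ Ioo ((0:ℝ) ^ 2 * (1 - 2 * 0)) ((1 / 3) ^ 2 * (1 - 2 * (1 / 3))) := by
      constructor <;> nlinarith
    exact h h4
  -- x₋ < p₁
  have hlt : xm < p := by
    by_contra hle
    push Not at hle
    have h1 := soloInformed_e_mono hp0.le hle hxm3.le
    have h2 := soloInformed_e_lt_E hxm0 hxm3
    nlinarith
  -- the quartic h(t) = q_F(t) + x' D_F(t) changes sign on [x₋, p₁]
  set h : ℝ → ℝ := fun t => soloInformedRhoQ F t + x' * soloInformedRhoD F t with hh
  have hc : ContinuousOn h (Icc xm p) := by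
    simp only [hh, soloInformedRhoQ, soloInformedRhoD]; fun_prop
  have hxmq : soloInformedRhoQ F xm = 0 := by
    unfold soloInformedRhoQ; nlinarith
  have hxmD : 0 < soloInformedRhoD F xm := by
    have := soloInformed_e_strictMono hxm0.le hlt hp3
    unfold soloInformedRhoD; nlinarith
  have hpq : 0 < soloInformedRhoQ F p := by
    have : soloInformedRhoQ F p = p * (p * (1 - p) ^ 2 - 4 * F) := by unfold soloInformedRhoQ; ring
    rw [this]
    refine mul_pos hp0 ?_
    have := soloInformed_e_lt_E hp0 hp3
    nlinarith
  have hpD : soloInformedRhoD F p = 0 := by unfold soloInformedRhoD; nlinarith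
  have ha : h xm < 0 := by
    simp only [hh, hxmq, zero_add]
    exact mul_neg_of_neg_of_pos hx' hxmD
  have hb : 0 < h p := by
    simp only [hh, hpD, mul_zero, add_zero]; exact hpq
  obtain ⟨x, ⟨hx1, hx2⟩, hx0⟩ : ∃ x ∈ Ioo xm p, h x = 0 :=
    intermediate_value_Ioo hlt.le hc ⟨ha, hb⟩
  have hxdom : x ∈ soloInformedRhoDom F := by
    refine ⟨hxm0.trans hx1, hx2.trans hp3, ?_, ?_⟩
    · have := soloInformed_e_strictMono (hxm0.trans hx1).le hx2 hp3
      linarith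
    · have := soloInformed_E_strictMono hx1 (hx2.trans hp3)
      linarith
  refine ⟨x, hxdom, ?_⟩
  have hD := soloInformed_rhoD_pos hxdom
  unfold soloInformedRho
  rw [div_eq_iff hD.ne']
  simp only [hh] at hx0
  linarith

/-! ### The two sheets over `x` -/

/-- Over `x ∈ S_F`, the upper-sheet point `(x, y₊)`, `y₊ = ((1−x) + √((1−x)² − 4F/x))/2`, lies on
`E_F` and in the chamber `C₀ = {0 < x < z < y}`. [this work] -/
theorem soloInformed_upperSheet {F x : ℝ} (hx : x ∈ soloInformedRhoDom F) :
    soloInformedHesseF x (((1 - x) + Real.sqrt ((1 - x) ^ 2 - 4 * F / x)) / 2) = F ∧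
      x < 1 - x - ((1 - x) + Real.sqrt ((1 - x) ^ 2 - 4 * F / x)) / 2 ∧
      1 - x - ((1 - x) + Real.sqrt ((1 - x) ^ 2 - 4 * F / x)) / 2 <
        ((1 - x) + Real.sqrt ((1 - x) ^ 2 - 4 * F / x)) / 2 := by
  obtain ⟨h0, h3, he, hE⟩ := hx
  set r := (1 - x) ^ 2 - 4 * F / x with hr
  have hr0 : 0 < r := by
    rw [hr, sub_pos, div_lt_iff₀ h0]; linarith
  set s := Real.sqrt r with hs
  have hs0 : 0 < s := Real.sqrt_pos.2 hr0
  have hss : s * s = r := Real.mul_self_sqrt hr0.le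
  refine ⟨?_, ?_, by linarith⟩
  · unfold soloInformedHesseF
    have : x * (((1 - x) + s) / 2) * (1 - x - ((1 - x) + s) / 2) = x * (((1 - x) ^ 2 - s * s) / 4) := by
      ring
    rw [this, hss, hr]
    field_simp
    ring
  · -- x < z ⟺ s < 1 - 3x ⟺ r < (1-3x)² ⟺ x²(1-2x) < F
    have h13 : 0 < 1 - 3 * x := by linarith
    have hslt : s < 1 - 3 * x := by
      rw [hs, Real.sqrt_lt' h13, hr, sub_lt_iff_lt_add, ← sub_lt_iff_lt_add', lt_div_iff₀ h0]
      nlinarith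
    linarith

/-- A point of the outer branch `B₃ = {x < 0, y < 0}` is determined by `x` and `F`: if
`y₁, y₂ < 0` and `F(x,y₁) = F(x,y₂)` with `x < 0` then `y₁ = y₂`. [this work] -/
theorem soloInformed_negRoot_unique {x y₁ y₂ : ℝ} (hx : x < 0) (h1 : y₁ < 0) (h2 : y₂ < 0)
    (h : soloInformedHesseF x y₁ = soloInformedHesseF x y₂) : y₁ = y₂ := by
  unfold soloInformedHesseF at h
  have h' : (y₁ - y₂) * (1 - x - y₁ - y₂) = 0 := by
    have hx' : x ≠ 0 := hx.ne
    have : x * ((y₁ - y₂) * (1 - x - y₁ - y₂)) = 0 := by nlinarith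
    simpa [hx'] using this
  rcases mul_eq_zero.1 h' with h' | h'
  · linarith
  · linarith

end Summit.KontsevichZagierPeriods.KontsevichZagierPeriods.Theorems
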